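import Mathlib
import Summits.NavierStokesRegularity.NavierStokesRegularity.Theorems.EulerZoomLiouvillePowerGaugeEulerLiouvilleSelfSimilarGenericHyperbolic
import Literature.Analysis.FluidPDE.SelfSimilarEulerBernoulliCap
import Literature.Analysis.FluidPDE.SelfSimilarEulerOutgoingExclusionTools
import Literature.Analysis.FluidPDE.SelfSimilarCollapseAnsatz
import HarnessLib

/-!
# Rung C1 of the crux `EulerZoomLiouville.PowerGaugeEulerLiouville`: step (M) of «hyperbolic-stagnation exclusion»
# under the CIV far field (3.8), and at MEMBER level — a stratum of `stub_selfSimilarExtremalRest`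
# (route №10, item stmt-NavierStokesRegularity-19832; `--supports`)

Helper file (theorems only). Seat ns-typeII-p3 (cell ns-regularity-ideate §B, D-0081).  Fourth sequel to
`…SelfSimilarFiniteHyperbolic`.  The profile theorems there (`eq_zero_of_finite_nodalSet`,
`eq_zero_of_finiteHyperbolicStagnation`) and in `…SelfSimilarGenericHyperbolic`
(`eq_zero_of_finite_genericHyperbolicStagnation`) carried five side hypotheses — `V` bounded, `‖DV‖ ≤ K`, `P` bounded
above, `DV → 0`, `V(0) = 0`.  Under the far-field bounds (3.8) of Constantin–Ignatova–Vicol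
(`HasSelfSimilarFarFieldWith γ 0 C V`) ALL FIVE ARE TREE THEOREMS (typeII-p2's Literature files:
`HasSelfSimilarFarFieldWith.norm_le_rpow / norm_fderiv_le / tendsto_norm_fderiv / apply_center`,
`IsSelfSimilarEulerProfile.pressure_le_of_hasSelfSimilarFarFieldWith`), and moreover the BERNOULLI-TOP stagnation
points are automatically FAT (`IsSelfSimilarEulerProfile.exists_irrotational_bernoulliCap`: `curl V ≡ 0` on an open
Bernoulli cap containing every global maximiser of `ℋ`).  Hence:

* **`eq_zero_of_farField_of_finite_nodalSet`** — `0 < γ < ½`, `V` smooth with (3.8), `𝒩_W` finite, every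
  stagnation point that is NOT a global Bernoulli maximiser is fat or thin ⇒ `V ≡ 0` (mod the Robinson fact);
* **`eq_zero_of_farField_of_genericHyperbolicStagnation`** — the same with «fat or thin» replaced by the generic real
  block normal form of `DW(z)` (`d₀, d₁` of one strict sign, `d₂ ≠ 0`) at the non-top nodes;
* **`selfSimilar_ae_eq_zero_of_finite_nodalSet`, `selfSimilar_ae_eq_zero_of_genericHyperbolicStagnation`** —
  MEMBER LEVEL, in the binder shape of the lineage's strata (`u(τ) = selfSimilarCollapse (1/(2+ρ)) 0 V τ` for
  `τ < 0`, any `ρ > 0`): such an exactly self-similar field vanishes a.e. on `(−∞,0) × ℝ³`.  This is a stratum of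
  the open registered stub `stub_selfSimilarExtremalRest` (classical profiles with (3.8) in the sub-critical window
  whose stagnation set is finite and generic-hyperbolic away from the Bernoulli top), conditional only on the
  cited named fact `Robinson1999_stableManifoldTheorem`.

Refuter reading: with (3.8), a refuting classical profile of rung C1 has ≥ 2 stagnation points (tree
`exists_two_stagnation_points`), the top one fat; it must carry, BELOW the Bernoulli top, infinitely many stagnation
points or one whose linearisation `γI + DV(z)` has an eigenvalue on the imaginary axis or a repeated eigenvalue
without a signed block basis.

WHAT THIS IS NOT: not NS, not E, not the stub — classical (3.8)-profiles with finite generic-hyperbolic stagnation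
set only, modulo the Robinson fact.  [folklore; cf. ConstantinIgnatovaVicol2026Putative §3.1.3 (3.8), §3.4.3–§3.5;
Robinson1999 Ch. V Thm 10.1]
-/

noncomputable section

-- flat `Theorems/<Route><Decl>…` files of one crux share the namespace of the crux (tree convention)
set_option linter.dupNamespace false

open MeasureTheory Set Filter Topology Metric Function InnerProductSpace
open scoped RealInnerProductSpace NNReal ContDiff

namespace Summit.NavierStokesRegularity.NavierStokesRegularity.Theorems.PowerGaugeEulerLiouville.Kelvin

open Literature.Analysis Literature.Analysis.FluidPDE Literature.Dynamics.FixedPoints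

variable {γ : ℝ} {V : EuclideanSpace ℝ (Fin 3) → EuclideanSpace ℝ (Fin 3)} {P : EuclideanSpace ℝ (Fin 3) → ℝ}

/-! ### The side hypotheses of step (M) from the far field (3.8) -/

/-- Under (3.8), `‖DV‖ ≤ C` everywhere. [cite: ConstantinIgnatovaVicol2026Putative, §3.1.3 eq. (3.8)] -/
theorem norm_fderiv_le_const_of_farField (hγ : 0 < γ) {C : ℝ} (hfar : HasSelfSimilarFarFieldWith γ 0 C V)
    (y : EuclideanSpace ℝ (Fin 3)) : ‖fderiv ℝ V y‖ ≤ C := by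
  have h1 := hfar.norm_fderiv_le y
  have h2 : (1 + ‖y - 0‖ ^ 2) ^ (-(1 / (2 * γ))) ≤ (1 : ℝ) :=
    Real.rpow_le_one_of_one_le_of_nonpos (by nlinarith [sq_nonneg ‖y - 0‖]) (by
      have : 0 < 1 / (2 * γ) := by positivity
      linarith)
  calc ‖fderiv ℝ V y‖ ≤ C * (1 + ‖y - 0‖ ^ 2) ^ (-(1 / (2 * γ))) := h1
    _ ≤ C * 1 := mul_le_mul_of_nonneg_left h2 hfar.nonneg
    _ = C := mul_one C

/-- Under (3.8) with `0 < γ < 1`, `‖V‖ ≤ C` everywhere. [cite: ConstantinIgnatovaVicol2026Putative, §3.1.3 eq. (3.8)] -/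
theorem norm_le_const_of_farField (hγ : 0 < γ) (hγ1 : γ < 1) {C : ℝ} (hfar : HasSelfSimilarFarFieldWith γ 0 C V)
    (y : EuclideanSpace ℝ (Fin 3)) : ‖V y‖ ≤ C := by
  have h1 := hfar.norm_le_rpow y
  have hexp : (1 - 1 / γ) / 2 ≤ 0 := by
    have : 1 < 1 / γ := by rw [lt_div_iff₀ hγ]; linarith
    linarith
  have h2 : (1 + ‖y - 0‖ ^ 2) ^ ((1 - 1 / γ) / 2) ≤ (1 : ℝ) :=
    Real.rpow_le_one_of_one_le_of_nonpos (by nlinarith [sq_nonneg ‖y - 0‖]) hexp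
  calc ‖V y‖ ≤ C * (1 + ‖y - 0‖ ^ 2) ^ ((1 - 1 / γ) / 2) := h1
    _ ≤ C * 1 := mul_le_mul_of_nonneg_left h2 hfar.nonneg
    _ = C := mul_one C

/-- **Bernoulli-top stagnation points are fat** (`0 < γ < ½`, (3.8)): if `z ∈ 𝒩_W` is a global maximiser of the
self-similar Bernoulli function `ℋ`, then `curl V ≡ 0` on a ball around `z` (the irrotational Bernoulli cap of
typeII-p2's `exists_irrotational_bernoulliCap` is an open set containing every global maximiser).
[cite: ConstantinIgnatovaVicol2026Putative, §3.4.3–§3.5 (structure at the Bernoulli maximum; not in print)] -/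
theorem fat_of_isMaxOn_bernoulli (hprof : IsSelfSimilarEulerProfile γ 0 V P) (hγ : 0 < γ) (hγ2 : γ < 1 / 2)
    {C : ℝ} (hfar : HasSelfSimilarFarFieldWith γ 0 C V) {z : EuclideanSpace ℝ (Fin 3)}
    (hmax : IsMaxOn (selfSimilarBernoulli γ 0 V P) univ z) :
    ∃ r : ℝ, 0 < r ∧ ∀ y : EuclideanSpace ℝ (Fin 3), ‖y - z‖ < r → curl V y = 0 := by
  obtain ⟨t, ⟨z', -, htz', hmax'⟩, hcap⟩ := hprof.exists_irrotational_bernoulliCap hγ hγ2 hfar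
  have htz : t < selfSimilarBernoulli γ 0 V P z := lt_of_lt_of_le htz' (hmax (mem_univ z'))
  have hHc : Continuous (selfSimilarBernoulli γ 0 V P) := hprof.contDiff_selfSimilarBernoulli.continuous
  have hopen : IsOpen {y | t < selfSimilarBernoulli γ 0 V P y} := isOpen_lt continuous_const hHc
  obtain ⟨r, hr, hball⟩ := Metric.isOpen_iff.1 hopen z htz
  refine ⟨r, hr, fun y hy => hcap y (hball ?_)⟩
  rwa [mem_ball, dist_eq_norm]

/-! ### Step (M) under the far field (3.8) -/

/-- **Step (M) under (3.8).**  Let `(V, P)` be a classical self-similar Euler profile with `V` smooth,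
`0 < γ < ½`, and the far-field bounds (3.8) centred at `0`.  If the stagnation set of `W = γy + V` is FINITE and
every stagnation point which is not a global maximiser of the Bernoulli function is FAT (`curl V ≡ 0` on a ball) or
THIN (`D(Φ_1)(z)` has a hyperbolic splitting with a contracting direction), then `V ≡ 0`.  Conditional on the
named fact `Robinson1999_stableManifoldTheorem`. [cite: ConstantinIgnatovaVicol2026Putative, §3.5 Thm 3.10 (strengthened); Robinson1999, Ch. V Thm 10.1] -/
theorem eq_zero_of_farField_of_finite_nodalSet (hSMT : Robinson1999_stableManifoldTheorem.{0})
    (hV : ContDiff ℝ ∞ V) (hprof : IsSelfSimilarEulerProfile γ 0 V P) (hγ : 0 < γ) (hγ2 : γ < 1 / 2)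
    {C : ℝ} (hfar : HasSelfSimilarFarFieldWith γ 0 C V) (hfin : (selfSimilarNodalSet γ 0 V).Finite)
    (hnodes : ∀ z ∈ selfSimilarNodalSet γ 0 V, ¬ IsMaxOn (selfSimilarBernoulli γ 0 V P) univ z →
      (∃ r : ℝ, 0 < r ∧ ∀ y : EuclideanSpace ℝ (Fin 3), ‖y - z‖ < r → curl V y = 0) ∨
      (∃ Es Eu : Submodule ℝ (EuclideanSpace ℝ (Fin 3)),
        IsHyperbolicSplitting
          (fderiv ℝ (ODE.evolutionMap (fun _ : ℝ => selfSimilarTransport γ 0 V) 0 1) z) Es Eu ∧ Eu ≠ ⊤)) :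
    V = 0 := by
  have hK : ∀ y, ‖fderiv ℝ V y‖ ≤ C := norm_fderiv_le_const_of_farField hγ hfar
  have hM : ∀ y, ‖V y‖ ≤ C := norm_le_const_of_farField hγ (by linarith) hfar
  have hP : ∀ y, P y ≤ P 0 + C * (1 + C) * (γ / (1 - 2 * γ)) :=
    hprof.pressure_le_of_hasSelfSimilarFarFieldWith hγ hγ2 hfar
  refine eq_zero_of_finite_nodalSet hSMT hV hK hprof hM hP hγ hγ2 hfin (fun z hz => ?_)
    (hfar.tendsto_norm_fderiv hγ) hfar.apply_center
  by_cases hmax : IsMaxOn (selfSimilarBernoulli γ 0 V P) univ z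
  · exact Or.inl (fat_of_isMaxOn_bernoulli hprof hγ hγ2 hfar hmax)
  · exact hnodes z hz hmax

/-- **Step (M) under (3.8), generic hyperbolic form.**  As `eq_zero_of_farField_of_finite_nodalSet`, with the
non-top stagnation points assumed GENERIC HYPERBOLIC: `DW(z) = γI + DV(z)` has a real block normal form
`A b₀ = d₀b₀ − βb₁`, `A b₁ = βb₀ + d₁b₁`, `A b₂ = d₂b₂` with `d₀, d₁` of one strict sign and `d₂ ≠ 0`.  Then
`V ≡ 0` (mod the Robinson fact). [cite: ConstantinIgnatovaVicol2026Putative, §3.5 Thms 3.8/3.10 (strengthened); Robinson1999, Ch. V Thm 10.1] -/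
theorem eq_zero_of_farField_of_genericHyperbolicStagnation (hSMT : Robinson1999_stableManifoldTheorem.{0})
    (hV : ContDiff ℝ ∞ V) (hprof : IsSelfSimilarEulerProfile γ 0 V P) (hγ : 0 < γ) (hγ2 : γ < 1 / 2)
    {C : ℝ} (hfar : HasSelfSimilarFarFieldWith γ 0 C V) (hfin : (selfSimilarNodalSet γ 0 V).Finite)
    (hnodes : ∀ z ∈ selfSimilarNodalSet γ 0 V, ¬ IsMaxOn (selfSimilarBernoulli γ 0 V P) univ z →
      ∃ (b : Module.Basis (Fin 3) ℝ (EuclideanSpace ℝ (Fin 3))) (lam : Fin 3 → ℝ) (β : ℝ),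
        (γ • ContinuousLinearMap.id ℝ (EuclideanSpace ℝ (Fin 3)) + fderiv ℝ V z) (b 0) = lam 0 • b 0 - β • b 1 ∧
        (γ • ContinuousLinearMap.id ℝ (EuclideanSpace ℝ (Fin 3)) + fderiv ℝ V z) (b 1) = β • b 0 + lam 1 • b 1 ∧
        (γ • ContinuousLinearMap.id ℝ (EuclideanSpace ℝ (Fin 3)) + fderiv ℝ V z) (b 2) = lam 2 • b 2 ∧
        ((0 < lam 0 ∧ 0 < lam 1) ∨ (lam 0 < 0 ∧ lam 1 < 0)) ∧ lam 2 ≠ 0) :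
    V = 0 := by
  have hK : ∀ y, ‖fderiv ℝ V y‖ ≤ C := norm_fderiv_le_const_of_farField hγ hfar
  refine eq_zero_of_farField_of_finite_nodalSet hSMT hV hprof hγ hγ2 hfar hfin fun z hz hmax => ?_
  obtain ⟨b, lam, β, hA0, hA1, hA2, hsign, h2ne⟩ := hnodes z hz hmax
  have htr := sum_blockDiag_eq_three_mul (γ := γ) hprof.divFree z b lam β hA0 hA1 hA2
  have hexp := fderiv_flow_one_eq_exp hV hK hz
  rcases hsign with ⟨h0p, h1p⟩ | ⟨h0n, h1n⟩
  · rcases lt_or_gt_of_ne h2ne with h2n | h2p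
    · obtain ⟨hsplit, hne⟩ := isHyperbolicSplitting_exp_of_blockBasis_neg _ b lam β hA0 hA1 hA2 h0p h1p h2n
      refine Or.inr ⟨Submodule.span ℝ {b 2}, Submodule.span ℝ {b 0, b 1}, ?_, hne⟩
      rw [hexp]
      exact hsplit
    · exact Or.inl (curl_eq_zero_near_blockSource hV hK hprof hγ2 hz b lam β hA0 hA1 hA2
        (fun i => by fin_cases i <;> assumption))
  · have h2p : 0 < lam 2 := by linarith
    obtain ⟨hsplit, hne⟩ := isHyperbolicSplitting_exp_of_blockBasis_pos _ b lam β hA0 hA1 hA2 h0n h1n h2p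
    refine Or.inr ⟨Submodule.span ℝ {b 0, b 1}, Submodule.span ℝ {b 2}, ?_, hne⟩
    rw [hexp]
    exact hsplit

/-! ### Member level: a stratum of `stub_selfSimilarExtremalRest` -/

/-- **A self-similar member whose profile vanishes identically vanishes on the slab.** [folklore] -/
theorem selfSimilar_ae_eq_zero_of_profile_eq_zero {γ' : ℝ}
    (u : ℝ → EuclideanSpace ℝ (Fin 3) → EuclideanSpace ℝ (Fin 3))
    (hu : ∀ τ : ℝ, τ < 0 → u τ = selfSimilarCollapse γ' 0 V τ) (hV0 : V = 0) :
    uncurry u =ᵐ[volume.restrict (Iio (0 : ℝ) ×ˢ (univ : Set (EuclideanSpace ℝ (Fin 3))))] 0 := by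
  have hS : MeasurableSet (Iio (0 : ℝ) ×ˢ (univ : Set (EuclideanSpace ℝ (Fin 3)))) :=
    measurableSet_Iio.prod MeasurableSet.univ
  refine (ae_restrict_mem hS).mono fun z hz => ?_
  obtain ⟨hτ, -⟩ := hz
  have hτ' : z.1 < 0 := hτ
  change u z.1 z.2 = 0
  rw [hu z.1 hτ', hV0, selfSimilarCollapse_zero]
  rfl

/-- **MEMBER LEVEL, fat-or-thin form** (any `ρ > 0`; `γ = 1/(2+ρ) ∈ (0, ½)`): an exactly self-similar field
`u(τ) = selfSimilarCollapse (1/(2+ρ)) 0 V τ` (`τ < 0`) whose classical profile (`V` smooth,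
`IsSelfSimilarEulerProfile (1/(2+ρ)) 0 V P`) has the far-field bounds (3.8), a FINITE stagnation set, and every
non-Bernoulli-top stagnation point fat or thin, vanishes a.e. on `(−∞, 0) × ℝ³`.  Conditional on the named fact
`Robinson1999_stableManifoldTheorem`. [cite: ConstantinIgnatovaVicol2026Putative, §3.5 (strengthened); Robinson1999, Ch. V Thm 10.1] -/
theorem selfSimilar_ae_eq_zero_of_finite_nodalSet {ρ : ℝ} (hρ : 0 < ρ)
    (hSMT : Robinson1999_stableManifoldTheorem.{0})
    (u : ℝ → EuclideanSpace ℝ (Fin 3) → EuclideanSpace ℝ (Fin 3))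
    (hu : ∀ τ : ℝ, τ < 0 → u τ = selfSimilarCollapse (1 / (2 + ρ)) 0 V τ)
    (hV : ContDiff ℝ ∞ V) (hprof : IsSelfSimilarEulerProfile (1 / (2 + ρ)) 0 V P)
    (hfar : HasSelfSimilarFarField (1 / (2 + ρ)) 0 V) (hfin : (selfSimilarNodalSet (1 / (2 + ρ)) 0 V).Finite)
    (hnodes : ∀ z ∈ selfSimilarNodalSet (1 / (2 + ρ)) 0 V,
      ¬ IsMaxOn (selfSimilarBernoulli (1 / (2 + ρ)) 0 V P) univ z →
      (∃ r : ℝ, 0 < r ∧ ∀ y : EuclideanSpace ℝ (Fin 3), ‖y - z‖ < r → curl V y = 0) ∨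
      (∃ Es Eu : Submodule ℝ (EuclideanSpace ℝ (Fin 3)),
        IsHyperbolicSplitting
          (fderiv ℝ (ODE.evolutionMap (fun _ : ℝ => selfSimilarTransport (1 / (2 + ρ)) 0 V) 0 1) z) Es Eu ∧
          Eu ≠ ⊤)) :
    uncurry u =ᵐ[volume.restrict (Iio (0 : ℝ) ×ˢ (univ : Set (EuclideanSpace ℝ (Fin 3))))] 0 := by
  have h2ρ : (0 : ℝ) < 2 + ρ := by linarith
  have hγ : (0 : ℝ) < 1 / (2 + ρ) := one_div_pos.2 h2ρ
  have hγ2 : 1 / (2 + ρ) < 1 / 2 := one_div_lt_one_div_of_lt two_pos (by linarith)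
  obtain ⟨C, hC⟩ := hfar
  exact selfSimilar_ae_eq_zero_of_profile_eq_zero u hu
    (eq_zero_of_farField_of_finite_nodalSet hSMT hV hprof hγ hγ2 hC hfin hnodes)

/-- **MEMBER LEVEL, generic hyperbolic form — the stratum of `stub_selfSimilarExtremalRest` contributed by the crux
idea «hyperbolic-stagnation exclusion»** (any `ρ > 0`): an exactly self-similar field
`u(τ) = selfSimilarCollapse (1/(2+ρ)) 0 V τ` whose classical profile (`V` smooth, CIV (3.3)) has the far-field bounds
(3.8) and a FINITE stagnation set of `y/(2+ρ) + V`, at each non-Bernoulli-top point of which the linearisation has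
the generic real block normal form (`d₀, d₁` of one strict sign, `d₂ ≠ 0` — every node with three distinct
eigenvalues off the imaginary axis), vanishes a.e. on `(−∞,0) × ℝ³`.  Conditional only on the cited named fact
`Robinson1999_stableManifoldTheorem`. [cite: ConstantinIgnatovaVicol2026Putative, §3.5 Thms 3.8/3.10 (strengthened); Robinson1999, Ch. V Thm 10.1] -/
theorem selfSimilar_ae_eq_zero_of_genericHyperbolicStagnation {ρ : ℝ} (hρ : 0 < ρ)
    (hSMT : Robinson1999_stableManifoldTheorem.{0})
    (u : ℝ → EuclideanSpace ℝ (Fin 3) → EuclideanSpace ℝ (Fin 3))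
    (hu : ∀ τ : ℝ, τ < 0 → u τ = selfSimilarCollapse (1 / (2 + ρ)) 0 V τ)
    (hV : ContDiff ℝ ∞ V) (hprof : IsSelfSimilarEulerProfile (1 / (2 + ρ)) 0 V P)
    (hfar : HasSelfSimilarFarField (1 / (2 + ρ)) 0 V) (hfin : (selfSimilarNodalSet (1 / (2 + ρ)) 0 V).Finite)
    (hnodes : ∀ z ∈ selfSimilarNodalSet (1 / (2 + ρ)) 0 V,
      ¬ IsMaxOn (selfSimilarBernoulli (1 / (2 + ρ)) 0 V P) univ z →
      ∃ (b : Module.Basis (Fin 3) ℝ (EuclideanSpace ℝ (Fin 3))) (lam : Fin 3 → ℝ) (β : ℝ),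
        ((1 / (2 + ρ)) • ContinuousLinearMap.id ℝ (EuclideanSpace ℝ (Fin 3)) + fderiv ℝ V z) (b 0) =
            lam 0 • b 0 - β • b 1 ∧
        ((1 / (2 + ρ)) • ContinuousLinearMap.id ℝ (EuclideanSpace ℝ (Fin 3)) + fderiv ℝ V z) (b 1) =
            β • b 0 + lam 1 • b 1 ∧
        ((1 / (2 + ρ)) • ContinuousLinearMap.id ℝ (EuclideanSpace ℝ (Fin 3)) + fderiv ℝ V z) (b 2) = lam 2 • b 2 ∧
        ((0 < lam 0 ∧ 0 < lam 1) ∨ (lam 0 < 0 ∧ lam 1 < 0)) ∧ lam 2 ≠ 0) :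
    uncurry u =ᵐ[volume.restrict (Iio (0 : ℝ) ×ˢ (univ : Set (EuclideanSpace ℝ (Fin 3))))] 0 := by
  have h2ρ : (0 : ℝ) < 2 + ρ := by linarith
  have hγ : (0 : ℝ) < 1 / (2 + ρ) := one_div_pos.2 h2ρ
  have hγ2 : 1 / (2 + ρ) < 1 / 2 := one_div_lt_one_div_of_lt two_pos (by linarith)
  obtain ⟨C, hC⟩ := hfar
  exact selfSimilar_ae_eq_zero_of_profile_eq_zero u hu
    (eq_zero_of_farField_of_genericHyperbolicStagnation hSMT hV hprof hγ hγ2 hC hfin hnodes)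

end Summit.NavierStokesRegularity.NavierStokesRegularity.Theorems.PowerGaugeEulerLiouville.Kelvin

end
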